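import Literature.Topology.FourManifolds.SurfaceGroupNielsenGenusOne
import Literature.Topology.FourManifolds.SurfaceGroupEpimorphismsProofs
import Literature.GroupTheory.CombinatorialGroupTheory.QuadraticWordsForm
import Mathlib.GroupTheory.FreeGroup.CyclicallyReduced
import HarnessLib

/-!
# Nielsen's lifting theorem after Zieschang: the set-up (definitions)

Topic `Literature/Topology/FourManifolds`.  Vocabulary for the algebraic proof of Nielsen's
theorem (the named fact `nielsen_surfaceGroup_mulEquiv_lift`,
`TrisectionFunctorGKStabilizationSplit.lean`: every automorphism of
`S_g = ⟨a₀, b₀, …, a_{g-1}, b_{g-1} ∣ r_g = ∏ [aᵢ, bᵢ]⟩` is induced by an automorphism of the free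
group `F = F⟨a, b⟩` sending `r_g` to a conjugate of `r_g^{±1}`) along Zieschang's route
(Zieschang–Vogt–Coldewey, *Surfaces and Planar Discontinuous Groups*, LNM 835, §§5.2–5.6,
Thm. 5.6.1), cut into five pillars that are proved in sibling files and assembled in
`SurfaceGroupNielsenAssembly.lean`:

* `(A3)` **block lemma** (ZVC Thm. 5.3.6): the canonical binary product is indecomposable —
  for every *marking* `ψ` (an automorphism of `F` with `ψ (mk w) = r_g`, `w` an alternating
  quadratic word) and every symbol-closed proper block `P` of `w`, `ψ (mk P)` is non-trivial in
  `S_g` (`BlockLemma`);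
* `(CORE)` **homotopic shortening** (ZVC Thm. 5.2.6, Thm. 5.3.2, Cor. 5.3.5): an indecomposable
  assignment `φ` of the symbols in `S_g` has a lift `X'` to `F` for which the cyclically reduced
  form of `∏ [X'(aᵢ), X'(bᵢ)]` is a *simple circuit* in the Cayley graph of `S_g`
  (`HomotopicSimple`);
* `(B)` **planar counting** (ZVC Thm. 5.4.2, Cor. 5.4.3): a simple circuit which is a product of
  conjugates of `r_g^{±1}` with signed count `±1` is a cyclic rotation of the word `r_g^{±1}`
  (`SimpleCircuitRotation`);
* `(C1)` **mapping degree** (ZVC 5.5.1–5.5.3): for an endomorphism `Φ` of `F` inducing an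
  automorphism of `S_g`, Zieschang's degree form `θ = ω_{ξ₀,η₀}` (`relatorDegree`, the tree's
  Heisenberg form `omega` of `QuadraticWordsForm.lean`) takes the value `±g` on `Φ(r_g)`
  (`DegreeOfAut`);
* `(C2)` **Zieschang–Nielsen** (ZVC Cor. 5.2.13): an endomorphism of `F` sending `r_g` to a
  conjugate of `r_g^{±1}` is an automorphism (`RelatorEndIsAut`).

Here: the projection `proj g : F →* S_g`; the liftability predicate `Liftable`; the degree form
`relatorDegree` with its test vectors `degXi`, `degEta`; signed products of conjugates of the
relator `conjProd`, `signSum`; simple circuits `IsSimpleCircuit` (a non-empty reduced word, closed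
in `S_g`, whose proper prefixes have pairwise distinct values in `S_g` — a simple closed edge
path in the Cayley graph); `Indecomposable` and `MarkedNontrivial` assignments (ZVC 5.3.1 (b));
the five pillar statements; and the first bookkeeping lemmas.

## References

* H. Zieschang, E. Vogt, H.-D. Coldewey, *Surfaces and Planar Discontinuous Groups*, LNM 835,
  Springer (1980), §5.2 (5.2.6, 5.2.13), §5.3 (5.3.1, 5.3.2, 5.3.5, 5.3.6), §5.4 (5.4.2, 5.4.3),
  §5.5 (5.5.1–5.5.3), §5.6 (Thm. 5.6.1). [ZieschangVogtColdewey1980]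
* J. Nielsen, *Untersuchungen zur Topologie der geschlossenen zweiseitigen Flächen*, Acta Math.
  50 (1927) 189–358. [Nielsen1927]
* H. Zieschang, *Über Automorphismen ebener diskontinuierlicher Gruppen*, Math. Ann. 166 (1966)
  148–167. [Zieschang1966]
-/

noncomputable section

namespace Literature.Topology.FourManifolds

open Literature.GroupTheory.CombinatorialGroupTheory List

namespace SurfaceGroup

variable {g : ℕ}

/-! ## The projection and liftability -/

/-- The projection `F⟨a, b⟩ →* S_g`. [folklore] -/
abbrev proj (g : ℕ) : FreeGroup (surfaceGen g) →* SurfaceGroup g :=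
  PresentedGroup.mk ({surfaceRelator g} : Set (FreeGroup (surfaceGen g)))

/-- The kernel of the projection is the normal closure of the relator. [folklore] -/
theorem mem_ker_proj_iff (x : FreeGroup (surfaceGen g)) :
    x ∈ (proj g).ker ↔ x ∈ Subgroup.normalClosure ({surfaceRelator g} : Set (FreeGroup (surfaceGen g))) := by
  rw [MonoidHom.mem_ker]
  exact PresentedGroup.mk_eq_one_iff

/-- **Liftable automorphism** (the conclusion of Nielsen's theorem for one `α`): `α` is induced
by an automorphism `φ` of the free group with `φ(r_g) = c r_g^{ε} c⁻¹`, `ε = ±1`.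
[cite: ZieschangVogtColdewey1980, Thm. 5.6.1] -/
def Liftable (α : SurfaceGroup g ≃* SurfaceGroup g) : Prop :=
  ∃ (φ : FreeGroup (surfaceGen g) ≃* FreeGroup (surfaceGen g)) (c : FreeGroup (surfaceGen g))
    (ε : ℤ), (ε = 1 ∨ ε = -1) ∧ φ (surfaceRelator g) = c * surfaceRelator g ^ ε * c⁻¹ ∧
    ∀ x, PresentedGroup.mk _ (φ x) = α (PresentedGroup.mk _ x)

/-- Nielsen's theorem is the liftability of every automorphism of every `S_g`. [folklore] -/
theorem nielsen_iff_forall_liftable :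
    nielsen_surfaceGroup_mulEquiv_lift ↔ ∀ (g : ℕ) (α : SurfaceGroup g ≃* SurfaceGroup g), Liftable α :=
  Iff.rfl

/-! ## Zieschang's degree form `θ` (ZVC 5.5.1) -/

/-- The test vector `ξ₀`: `aᵢ ↦ 1`, `bᵢ ↦ 0`. [cite: ZieschangVogtColdewey1980, 5.5.1] -/
def degXi (g : ℕ) : surfaceGen g → ℤ := fun x => if x.2 then 0 else 1

/-- The test vector `η₀`: `aᵢ ↦ 0`, `bᵢ ↦ 1`. [cite: ZieschangVogtColdewey1980, 5.5.1] -/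
def degEta (g : ℕ) : surfaceGen g → ℤ := fun x => if x.2 then 1 else 0

/-- **Zieschang's degree form** `θ = ω_{ξ₀, η₀} : F → ℤ` (the central coordinate of the
Heisenberg image, `omega` of `QuadraticWordsForm.lean`): on the normal closure of `r_g` it is the
homomorphism `K r_g^{ε} K⁻¹ ↦ ε·g` of ZVC Lemma 5.5.1 (times `g`).
[cite: ZieschangVogtColdewey1980, 5.5.1] -/
def relatorDegree (g : ℕ) (x : FreeGroup (surfaceGen g)) : ℤ := omega (degXi g) (degEta g) x

/-- The signed exponent of a Boolean sign. [folklore] -/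
def bsign (s : Bool) : ℤ := if s then 1 else -1

/-- **Signed product of conjugates of the relator**: `∏ⱼ Kⱼ r_g^{εⱼ} Kⱼ⁻¹` for a list of pairs
`(Kⱼ, εⱼ)` (`εⱼ = bsign sⱼ`). [cite: ZieschangVogtColdewey1980, §5.4] -/
def conjProd (L : List (FreeGroup (surfaceGen g) × Bool)) : FreeGroup (surfaceGen g) :=
  (L.map fun p => p.1 * surfaceRelator g ^ bsign p.2 * p.1⁻¹).prod

/-- The signed count `∑ⱼ εⱼ` of such a product. [cite: ZieschangVogtColdewey1980, §5.4] -/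
def signSum (L : List (FreeGroup (surfaceGen g) × Bool)) : ℤ := (L.map fun p => bsign p.2).sum

omit g in
/-- `conjProd` of a cons. [folklore] -/
theorem conjProd_cons {g : ℕ} (p : FreeGroup (surfaceGen g) × Bool) (L : List (FreeGroup (surfaceGen g) × Bool)) :
    conjProd (p :: L) = p.1 * surfaceRelator g ^ bsign p.2 * p.1⁻¹ * conjProd L := rfl

omit g in
/-- `signSum` of a cons. [folklore] -/
theorem signSum_cons {g : ℕ} (p : FreeGroup (surfaceGen g) × Bool) (L : List (FreeGroup (surfaceGen g) × Bool)) :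
    signSum (p :: L) = bsign p.2 + signSum L := by
  simp [signSum]

/-- **Every element of the normal closure of the relator is a signed product of conjugates.**
[folklore] -/
theorem exists_conjProd_of_mem_ker {x : FreeGroup (surfaceGen g)} (hx : x ∈ (proj g).ker) :
    ∃ L : List (FreeGroup (surfaceGen g) × Bool), x = conjProd L := by
  rw [mem_ker_proj_iff, Subgroup.normalClosure, Subgroup.mem_closure] at hx
  -- the set of signed products of conjugates is a subgroup containing the conjugates of `r`
  let H : Subgroup (FreeGroup (surfaceGen g)) :=
    { carrier := {y | ∃ L : List (FreeGroup (surfaceGen g) × Bool), y = conjProd L}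
      mul_mem' := by
        rintro a b ⟨La, rfl⟩ ⟨Lb, rfl⟩
        refine ⟨La ++ Lb, ?_⟩
        simp [conjProd, List.map_append, List.prod_append]
      one_mem' := ⟨[], by simp [conjProd]⟩
      inv_mem' := by
        rintro a ⟨La, rfl⟩
        refine ⟨(La.map fun p => (p.1, !p.2)).reverse, ?_⟩
        simp only [conjProd]
        rw [List.prod_inv_reverse, List.map_reverse, List.map_map, List.map_map]
        have key : ∀ p : FreeGroup (surfaceGen g) × Bool,
            ((fun x : FreeGroup (surfaceGen g) => x⁻¹) ∘ fun p : FreeGroup (surfaceGen g) × Bool =>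
              p.1 * surfaceRelator g ^ bsign p.2 * p.1⁻¹) p =
            ((fun p : FreeGroup (surfaceGen g) × Bool => p.1 * surfaceRelator g ^ bsign p.2 * p.1⁻¹) ∘
              fun p : FreeGroup (surfaceGen g) × Bool => (p.1, !p.2)) p := by
          intro p
          simp only [Function.comp_apply, mul_inv_rev, inv_inv, mul_assoc, ← zpow_neg]
          cases p.2 <;> simp [bsign]
        rw [List.map_congr_left (fun p _ => key p)] }
  refine hx H ?_
  intro y hy
  obtain ⟨s, hs, hy⟩ := Group.mem_conjugatesOfSet_iff.1 hy
  rw [Set.mem_singleton_iff] at hs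
  subst hs
  obtain ⟨c, rfl⟩ := isConj_iff.1 hy
  refine ⟨[(c, true)], ?_⟩
  simp [conjProd, bsign]

/-! ## Simple circuits in the Cayley graph of `S_g` -/

/-- **Simple circuit**: a non-empty reduced word, trivial in `S_g`, whose proper prefixes have
pairwise distinct values in `S_g` — a simple closed edge path in the Cayley graph of `S_g` with
respect to `a, b` (ZVC 5.3.1 (c): "simple" binary products). [cite: ZieschangVogtColdewey1980, 5.3.1 (c)] -/
def IsSimpleCircuit (w : List (surfaceGen g × Bool)) : Prop :=
  w ≠ [] ∧ FreeGroup.IsReduced w ∧ proj g (FreeGroup.mk w) = 1 ∧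
    ∀ k l : ℕ, k < l → l < w.length →
      proj g (FreeGroup.mk (w.take k)) ≠ proj g (FreeGroup.mk (w.take l))

/-! ## Indecomposable assignments (ZVC 5.3.1 (b)) -/

/-- **Indecomposable assignment** `φ` of the symbols `a, b` in `S_g` (ZVC 5.3.1 (b), for the
canonical word and all binary products *related* to it): for every marking `ψ` — an automorphism
of the free group carrying an alternating quadratic word `w = A P B` onto the relator — and every
non-empty proper block `P` of `w` closed under taking partner letters, the value
`φ̂(ψ(mk P))` of the block is non-trivial in `S_g`. [cite: ZieschangVogtColdewey1980, 5.3.1 (b)] -/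
def Indecomposable (φ : surfaceGen g → SurfaceGroup g) : Prop :=
  ∀ (ψ : FreeGroup (surfaceGen g) ≃* FreeGroup (surfaceGen g)) (A P B : List (surfaceGen g × Bool)),
    ψ (FreeGroup.mk (A ++ P ++ B)) = surfaceRelator g → IsQuadratic (A ++ P ++ B) →
    (∀ x ∈ P, ∀ y ∈ A ++ B, x.1 ≠ y.1) → P ≠ [] → A ++ B ≠ [] →
    FreeGroup.lift φ (ψ (FreeGroup.mk P)) ≠ 1

/-- **Marked non-triviality**: under every automorphism of the free group, every generator has a
non-trivial value under `φ̂` (no factor of any related binary product is `1`; ZVC 5.3, proof of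
Thm. 5.3.2, first sentence). [cite: ZieschangVogtColdewey1980, proof of Thm. 5.3.2] -/
def MarkedNontrivial (φ : surfaceGen g → SurfaceGroup g) : Prop :=
  ∀ (ψ : FreeGroup (surfaceGen g) ≃* FreeGroup (surfaceGen g)) (i : surfaceGen g),
    FreeGroup.lift φ (ψ (FreeGroup.of i)) ≠ 1

/-! ## The five pillars -/

/-- **(A3) Block lemma** (ZVC Thm. 5.3.6 for the canonical product): for every marking `ψ` of an
alternating quadratic word `A P B` (`ψ (mk (A P B)) = r_g`) and every non-empty proper
symbol-closed block `P`, `ψ (mk P) ≠ 1` in `S_g`. [cite: ZieschangVogtColdewey1980, Thm. 5.3.6] -/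
def BlockLemma (g : ℕ) : Prop :=
  ∀ (ψ : FreeGroup (surfaceGen g) ≃* FreeGroup (surfaceGen g)) (A P B : List (surfaceGen g × Bool)),
    ψ (FreeGroup.mk (A ++ P ++ B)) = surfaceRelator g → IsQuadratic (A ++ P ++ B) →
    (∀ x ∈ P, ∀ y ∈ A ++ B, x.1 ≠ y.1) → P ≠ [] → A ++ B ≠ [] →
    proj g (ψ (FreeGroup.mk P)) ≠ 1

/-- **(CORE) Homotopic shortening** (ZVC Thm. 5.2.6 + Thm. 5.3.2 + Cor. 5.3.5): an indecomposable,
marked non-trivial assignment `φ` with a lift `X` has a lift `X'` (same values in `S_g`) such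
that the cyclically reduced form of `∏ [X'(aᵢ), X'(bᵢ)]` is a simple circuit.
[cite: ZieschangVogtColdewey1980, Thm. 5.3.2 and Cor. 5.3.5] -/
def HomotopicSimple (g : ℕ) : Prop :=
  ∀ (φ : surfaceGen g → SurfaceGroup g), Indecomposable φ → MarkedNontrivial φ →
    ∀ X : surfaceGen g → FreeGroup (surfaceGen g), (∀ i, proj g (X i) = φ i) →
    ∃ X' : surfaceGen g → FreeGroup (surfaceGen g), (∀ i, proj g (X' i) = φ i) ∧
      IsSimpleCircuit (g := g)
        (FreeGroup.reduceCyclically (FreeGroup.toWord (FreeGroup.lift X' (surfaceRelator g))))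

/-- **(B) Planar counting** (ZVC Thm. 5.4.2, Cor. 5.4.3): a simple circuit that is a signed product
of conjugates of `r_g^{±1}` with signed count `±1` is a rotation of the word `r_g` or of its formal
inverse. [cite: ZieschangVogtColdewey1980, Thm. 5.4.2 and Cor. 5.4.3] -/
def SimpleCircuitRotation (g : ℕ) : Prop :=
  ∀ (w : List (surfaceGen g × Bool)) (L : List (FreeGroup (surfaceGen g) × Bool)),
    IsSimpleCircuit (g := g) w → FreeGroup.mk w = conjProd L → (signSum L = 1 ∨ signSum L = -1) →
    ∃ k : ℕ, w = (surfaceWordStd g).rotate k ∨ w = (FreeGroup.invRev (surfaceWordStd g)).rotate k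

/-- **(C1) Mapping degree** (ZVC 5.5.1–5.5.3 and the first half of the proof of Thm. 5.6.1): an
endomorphism of the free group inducing an automorphism of `S_g` has degree `±1`, i.e. `θ` takes
the value `±g` on the image of the relator. [cite: ZieschangVogtColdewey1980, 5.5.2, 5.5.3, Thm. 5.6.1] -/
def DegreeOfAut (g : ℕ) : Prop :=
  ∀ (α : SurfaceGroup g ≃* SurfaceGroup g) (Φ : FreeGroup (surfaceGen g) →* FreeGroup (surfaceGen g)),
    (∀ x, proj g (Φ x) = α (proj g x)) →
    relatorDegree g (Φ (surfaceRelator g)) = g ∨ relatorDegree g (Φ (surfaceRelator g)) = -(g : ℤ)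

/-- **(C2) Zieschang–Nielsen** (ZVC Cor. 5.2.13, closed orientable case; Nielsen 1918 for `g = 1`):
an endomorphism of `F⟨a, b⟩` sending `r_g` to a conjugate of `r_g^{±1}` is an automorphism.
[cite: ZieschangVogtColdewey1980, Cor. 5.2.13] -/
def RelatorEndIsAut (g : ℕ) : Prop :=
  ∀ (Φ : FreeGroup (surfaceGen g) →* FreeGroup (surfaceGen g)) (c : FreeGroup (surfaceGen g)) (ε : ℤ),
    (ε = 1 ∨ ε = -1) → Φ (surfaceRelator g) = c * surfaceRelator g ^ ε * c⁻¹ → Function.Bijective Φ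

end SurfaceGroup

end Literature.Topology.FourManifolds

end
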